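import Summits.HodgeConjecture.HodgeConjecture.Theorems.K2LiuInertCartanIwasawaBlocks
import Literature.NumberTheory.Automorphic.HyperspecialUnitaryCartanAdicCompletion
import Literature.NumberTheory.Automorphic.HyperspecialUnitaryCartanUnique
import Literature.NumberTheory.Automorphic.UnitaryGroupFormTransport

/-!
# The Cartan family of `G_v = U(V)(L⁺_v)` at an INERT unramified place (LOCAL SEAM of s23, row 26 — inert half)

Track B ∕ K2-LIT, hLiu418 = stmt-HodgeConjecture-24832; DEPMAP `Cruxes/HLiu418/Lines/K2_Liu_LocalSeam_s23.md` §3 row 26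
(`K2LiuCartanUnitaryRankOneLocal`; LEAD F0P6-plan (g10) 03:05:31Z «row 26 for every non-split finite place»; this file = the INERT
UNRAMIFIED head, consumers #28i and #32dR). Helper (count-neutral, own head per LEAD R3); the split half is ★ `K2LiuCartanFamilySplit`.

For the K2Lit CURVE datum `V = ⟨dV⟩` (`N = 2`), a finite place `v` of `L⁺` INERT (`c w = w`) and UNRAMIFIED in `L`, a `σ_w`-fixed uniformizer `ϖ`,
an integral hyperbolic frame `T ∈ GL₂(𝒪_w)` of the place form (`diag(dV)_w = σ_w(T)ᵀ·antidiag(1,1)·T`, ★ K1⁺) and ANY family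
`t : ℕ → G_v` with `(t m)_w = T⁻¹ · diag(ϖ^m, ϖ^{−m}) · T` (binder form — #28i takes `t m := t₁^m`):

* `isCartanFamily_localInt_inert`: `t` is a ★ D7d `IsCartanFamily` for `K_v = ★ UnitaryGroup.localInt` — `G_v = ⨆_m K_v t_m K_v` DISJOINTLY.

Proof: transport of the tree's BRUHAT–TITS (4.4.3) for the quasi-split `U(σ_w, J₀)(L_w)` and its hyperspecial `K₀ = U ∩ GL₂(𝒪_w)`
(★ `HermitianLattice.bijective_heckeCosetMk_zpowDiagGL_unitary`, datum ★ `unramifiedLocalConjDatum_adicCompletion` re-based on `ϖ`) along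
`Ψ = (T · T⁻¹) ∘ ★ localPiNonsplitEquiv : G_v ≃* U(σ_w, J₀)(L_w)`, which maps `K_v` onto `K₀` (`T ∈ GL₂(𝒪_w)`) and `t_m` to `diag(ϖ^{(m,−m)})`;
`{a ∈ ℤ² antitone, a ∘ rev = −a} = {(m, −m) : m ∈ ℕ}`. [BruhatTits1972, (4.4.3)]; [Tits1979, §3.3.3]; [Macdonald1971, Ch. V §3].
No `def`, no `sorry`. HONEST LABEL: HC_CM is proved only modulo the printed citations (2 remaining named inputs: hLiu418 =
stmt-HodgeConjecture-24832, h413 = stmt-HodgeConjecture-24833) until rung 0 closes; this file is unconditional and moves no counter.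
-/

set_option autoImplicit false

set_option linter.dupNamespace false

noncomputable section

open scoped Matrix
open NumberField IsDedekindDomain Matrix

namespace Summit.HodgeConjecture.HodgeConjecture.Cruxes.HLiu418.K2LiuCartanFamilyInert

open Literature.NumberTheory.Automorphic Literature.NumberTheory.Automorphic.UnitaryGroup Literature.NumberTheory.Automorphic.HermitianLattice
open Literature.NumberTheory.GelbartRogawski1991 Literature.NumberTheory.GelbartRogawski1991.GRConstruction
open Literature.NumberTheory.K2Lit Literature.NumberTheory.K2Lit.SiegelDoubled Literature.NumberTheory.Automorphic.CartanUnique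

variable (L : Type) [Field L] [NumberField L] [IsCMField L]
variable (dV : Fin 2 → L) (v : HeightOneSpectrum (𝓞 (Fp L)))

/-- the antisymmetric antitone exponent vectors of `U(2)` are the `(m, −m)`, `m ∈ ℕ`: `a = (a₀.toNat, −a₀.toNat)`. [cite: BruhatTits1972, (4.4.3)] -/
theorem eq_vec_toNat_of_antitone_rev {a : Fin 2 → ℤ} (ha : Antitone a ∧ ∀ i, a (Fin.rev i) = -a i) :
    a = ![((a 0).toNat : ℤ), -((a 0).toNat : ℤ)] := by
  have h1 : a 1 = -a 0 := by simpa using ha.2 0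
  have h0 : 0 ≤ a 0 := by have := ha.1 (show (0 : Fin 2) ≤ 1 by decide); omega
  funext i
  fin_cases i
  · simp [Int.toNat_of_nonneg h0]
  · simp [h1, Int.toNat_of_nonneg h0]

/-- `(m, −m)` is antitone and `rev`-antisymmetric. [cite: BruhatTits1972, (4.4.3)] -/
theorem antitone_rev_vec (m : ℕ) : Antitone ![(m : ℤ), -(m : ℤ)] ∧ ∀ i, ![(m : ℤ), -(m : ℤ)] (Fin.rev i) = -![(m : ℤ), -(m : ℤ)] i := by
  refine ⟨?_, fun i => ?_⟩
  · intro i j hij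
    fin_cases i <;> fin_cases j <;> simp at hij ⊢
  · fin_cases i <;> simp [Fin.rev]

/-- **The Cartan decomposition of `G_v = U(V)(L⁺_v)` at an inert unramified place, as a ★ `IsCartanFamily`**: with `K_v = U(V)(𝒪_v)`
and `(t m)_w = T⁻¹·diag(ϖ^m, ϖ^{−m})·T` in an integral hyperbolic frame `T`, every `g ∈ G_v` lies in exactly one `K_v t_m K_v`.
[cite: BruhatTits1972, (4.4.3)] [cite: Tits1979, §3.3.3] [cite: Macdonald1971, Ch. V §3] -/
theorem isCartanFamily_localInt_inert (w : UnitaryGroup.PlacesOver L v) (hw : IsCMField.complexConj L • w.1 = w.1)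
    (hv : Algebra.IsUnramifiedIn (𝓞 L) v.asIdeal)
    {ϖ : w.1.adicCompletion L} (hϖ : Valued.v ϖ = WithZero.exp (-1 : ℤ))
    (hϖσ : galAdicCompletionMap (L := L) (IsCMField.complexConj L) hw ϖ = ϖ)
    (T : GL (Fin 2) (w.1.adicCompletion L)) (hTi : T ∈ glInt 2 (w.1.adicCompletion L))
    (hTJ : UnitaryGroup.placeForm (Matrix.diagonal dV) w.1 =
      formCongr (galAdicCompletionMap (L := L) (IsCMField.complexConj L) hw) T ((StdForm.antidiagonal 2).over (w.1.adicCompletion L)))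
    (t : ℕ → UnitaryGroup.localPi L (IsCMField.complexConj L) 2 (Matrix.diagonal dV) v)
    (ht : ∀ m, Units.val ((t m : UnitaryGroup.LocalGLPi L 2 v) w) =
      ((T⁻¹ : GL (Fin 2) (w.1.adicCompletion L)) : Matrix (Fin 2) (Fin 2) (w.1.adicCompletion L)) *
        Matrix.diagonal ![ϖ ^ m, (ϖ ^ m)⁻¹] * (T : Matrix (Fin 2) (Fin 2) (w.1.adicCompletion L))) :
    IsCartanFamily (UnitaryGroup.localInt L (IsCMField.complexConj L) 2 (Matrix.diagonal dV) v) t := by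
  classical
  haveI : Algebra.IsQuadraticExtension (Fp L) L := IsCMField.isQuadraticExtension L
  have hc : IsCMField.complexConj L ≠ 1 := IsCMField.complexConj_ne_one L
  set σ : w.1.adicCompletion L →+* w.1.adicCompletion L := galAdicCompletionMap (L := L) (IsCMField.complexConj L) hw with hσ
  have hϖ0 : ϖ ≠ 0 := uniformizer_ne_zero hϖ
  -- the datum of the tree's hyperspecial Cartan theory, re-based on the given uniformizer
  obtain ⟨ϖ₀, hd₀⟩ := unramifiedLocalConjDatum_adicCompletion (IsCMField.complexConj L) hc v w hw hv
  have hd : UnramifiedLocalConjDatum σ ϖ := ⟨hd₀.σσ, hd₀.vσ, hϖσ, hϖ, hd₀.trace, hd₀.norm⟩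
  -- `Ψ : G_v ≃* U(σ_w, J₀)(L_w)`, `g ↦ T g_w T⁻¹`
  have hUU : unitaryGroupOfForm σ (UnitaryGroup.placeForm (Matrix.diagonal dV) w.1) =
      unitaryGroupOfForm σ (formCongr σ T ((StdForm.antidiagonal 2).over (w.1.adicCompletion L))) := by rw [hTJ]
  let Ψ : UnitaryGroup.localPi L (IsCMField.complexConj L) 2 (Matrix.diagonal dV) v ≃*
      unitaryGroupOfForm σ ((StdForm.antidiagonal 2).over (w.1.adicCompletion L)) :=
    (localPiNonsplitEquiv (IsCMField.complexConj L) (Matrix.diagonal dV) hc w hw).toMulEquiv.trans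
      ((MulEquiv.subgroupCongr hUU).trans (unitaryGroupOfFormCongr σ T ((StdForm.antidiagonal 2).over (w.1.adicCompletion L))).toMulEquiv)
  have hΨ : ∀ u, ((Ψ u : unitaryGroupOfForm σ ((StdForm.antidiagonal 2).over (w.1.adicCompletion L))) : GL (Fin 2) (w.1.adicCompletion L)) =
      T * (u : UnitaryGroup.LocalGLPi L 2 v) w * T⁻¹ := fun u => rfl
  -- `K_v ↔ K₀ = U(σ_w, J₀) ∩ GL₂(𝒪_w)` under `Ψ` (`T ∈ GL₂(𝒪_w)`)
  have hgl : ∀ g : GL (Fin 2) (w.1.adicCompletion L), g ∈ glInt 2 (w.1.adicCompletion L) ↔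
      (∀ i j, Valued.v ((g : Matrix (Fin 2) (Fin 2) (w.1.adicCompletion L)) i j) ≤ 1) ∧
        ∀ i j, Valued.v (((g⁻¹ : GL (Fin 2) (w.1.adicCompletion L)) : Matrix (Fin 2) (Fin 2) (w.1.adicCompletion L)) i j) ≤ 1 := by
    intro g
    rw [mem_glInt_adicCompletion_iff]
    simp only [HeightOneSpectrum.mem_adicCompletionIntegers]
  have hKΨ : ∀ u, u ∈ UnitaryGroup.localInt L (IsCMField.complexConj L) 2 (Matrix.diagonal dV) v ↔
      Ψ u ∈ unitaryInt σ ((StdForm.antidiagonal 2).over (w.1.adicCompletion L)) := by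
    intro u
    rw [mem_localInt_iff_of_smul_eq (IsCMField.complexConj L) 2 (Matrix.diagonal dV) hc w hw u, mem_unitaryInt_iff, hΨ, ← hgl]
    constructor
    · intro h; exact Subgroup.mul_mem _ (Subgroup.mul_mem _ hTi h) (Subgroup.inv_mem _ hTi)
    · intro h
      have h' := Subgroup.mul_mem _ (Subgroup.mul_mem _ (Subgroup.inv_mem _ hTi) h) hTi
      rwa [show T⁻¹ * (T * (u : UnitaryGroup.LocalGLPi L 2 v) w * T⁻¹) * T = (u : UnitaryGroup.LocalGLPi L 2 v) w by group] at h'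
  -- `Ψ (t m) = diag(ϖ^m, ϖ^{−m})`
  have hΨt : ∀ m : ℕ, Ψ (t m) = ⟨zpowDiagGL hϖ0 ![(m : ℤ), -(m : ℤ)], zpowDiagGL_mem_unitaryGroupOfForm hϖσ _ (antitone_rev_vec m).2⟩ := by
    intro m
    apply Subtype.ext
    apply Units.ext
    rw [show ((Ψ (t m) : unitaryGroupOfForm σ ((StdForm.antidiagonal 2).over (w.1.adicCompletion L))) : GL (Fin 2) (w.1.adicCompletion L)) =
      T * (t m : UnitaryGroup.LocalGLPi L 2 v) w * T⁻¹ from hΨ (t m), Units.val_mul, Units.val_mul, ht m, coe_zpowDiagGL]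
    have h1 : (T : Matrix (Fin 2) (Fin 2) (w.1.adicCompletion L)) * ((T⁻¹ : GL (Fin 2) (w.1.adicCompletion L)) : Matrix _ _ _) = 1 := by
      rw [← Units.val_mul, mul_inv_cancel, Units.val_one]
    have hD : (Matrix.diagonal ![ϖ ^ m, (ϖ ^ m)⁻¹] : Matrix (Fin 2) (Fin 2) (w.1.adicCompletion L)) = Matrix.diagonal fun i => ϖ ^ (![(m : ℤ), -(m : ℤ)] i) := by
      congr 1; funext i; fin_cases i <;> simp [zpow_natCast, _root_.zpow_neg]
    calc (T : Matrix (Fin 2) (Fin 2) (w.1.adicCompletion L)) *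
          (((T⁻¹ : GL (Fin 2) (w.1.adicCompletion L)) : Matrix _ _ _) * Matrix.diagonal ![ϖ ^ m, (ϖ ^ m)⁻¹] * (T : Matrix _ _ _)) *
          ((T⁻¹ : GL (Fin 2) (w.1.adicCompletion L)) : Matrix _ _ _)
        = ((T : Matrix (Fin 2) (Fin 2) (w.1.adicCompletion L)) * ((T⁻¹ : GL (Fin 2) (w.1.adicCompletion L)) : Matrix _ _ _)) *
            Matrix.diagonal ![ϖ ^ m, (ϖ ^ m)⁻¹] *
            ((T : Matrix (Fin 2) (Fin 2) (w.1.adicCompletion L)) * ((T⁻¹ : GL (Fin 2) (w.1.adicCompletion L)) : Matrix _ _ _)) := by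
          simp only [Matrix.mul_assoc]
      _ = Matrix.diagonal fun i => ϖ ^ (![(m : ℤ), -(m : ℤ)] i) := by rw [h1, Matrix.one_mul, Matrix.mul_one, hD]
  refine ⟨fun g => ?_, fun m m' hmm' => ?_⟩
  · -- COVER: Bruhat–Tits (4.4.3) in the `J₀`-model, pulled back along `Ψ`
    obtain ⟨⟨a, ha⟩, hga⟩ := (bijective_heckeCosetMk_zpowDiagGL_unitary (N := 2) hd).2
      (HeckeCoset.mk (unitaryInt σ ((StdForm.antidiagonal 2).over (w.1.adicCompletion L)))
        (unitaryInt σ ((StdForm.antidiagonal 2).over (w.1.adicCompletion L))) ⟨Ψ g, Submonoid.mem_top _⟩)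
    obtain ⟨k₁, hk₁, k₂, hk₂, h⟩ := (heckeAlgebra.heckeCosetMk_eq_iff (unitaryInt σ ((StdForm.antidiagonal 2).over (w.1.adicCompletion L)))
      (Submonoid.mem_top _) (Submonoid.mem_top _)).1 hga
    obtain ⟨m, rfl⟩ : ∃ m : ℕ, a = ![(m : ℤ), -(m : ℤ)] := ⟨_, eq_vec_toNat_of_antitone_rev ha⟩
    refine ⟨m, DoubleCoset.mem_doubleCoset.2 ⟨Ψ.symm k₁, (hKΨ _).2 (by rw [MulEquiv.apply_symm_apply]; exact hk₁), Ψ.symm k₂,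
      (hKΨ _).2 (by rw [MulEquiv.apply_symm_apply]; exact hk₂), ?_⟩⟩
    apply Ψ.injective
    rw [map_mul, map_mul, MulEquiv.apply_symm_apply, MulEquiv.apply_symm_apply, hΨt]
    exact h
  · -- DISJOINTNESS: uniqueness of the antitone exponents in the `J₀`-model
    obtain ⟨g, hg, hg'⟩ := hmm'
    obtain ⟨x, hx, y, hy, hgxy⟩ := DoubleCoset.mem_doubleCoset.1 hg
    obtain ⟨x', hx', y', hy', hgxy'⟩ := DoubleCoset.mem_doubleCoset.1 hg'
    have ha : Ψ g = Ψ x * ⟨zpowDiagGL hϖ0 ![(m : ℤ), -(m : ℤ)], zpowDiagGL_mem_unitaryGroupOfForm hϖσ _ (antitone_rev_vec m).2⟩ * Ψ y := by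
      rw [hgxy, map_mul, map_mul, hΨt]
    have hb : Ψ g = Ψ x' * ⟨zpowDiagGL hϖ0 ![(m' : ℤ), -(m' : ℤ)], zpowDiagGL_mem_unitaryGroupOfForm hϖσ _ (antitone_rev_vec m').2⟩ * Ψ y' := by
      rw [hgxy', map_mul, map_mul, hΨt]
    have key := eq_of_unitaryInt_mul_zpowDiagGL_mul_eq_of_antitone (N := 2) hϖ hϖσ (antitone_rev_vec m) (antitone_rev_vec m')
      (k₁ := (Ψ x')⁻¹ * Ψ x) (k₂ := Ψ y * (Ψ y')⁻¹)
      (Subgroup.mul_mem _ (Subgroup.inv_mem _ ((hKΨ _).1 hx')) ((hKΨ _).1 hx))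
      (Subgroup.mul_mem _ ((hKΨ _).1 hy) (Subgroup.inv_mem _ ((hKΨ _).1 hy'))) (by
        calc (Ψ x')⁻¹ * Ψ x * ⟨zpowDiagGL hϖ0 ![(m : ℤ), -(m : ℤ)], zpowDiagGL_mem_unitaryGroupOfForm hϖσ _ (antitone_rev_vec m).2⟩ *
              (Ψ y * (Ψ y')⁻¹)
            = (Ψ x')⁻¹ * (Ψ x * ⟨zpowDiagGL hϖ0 ![(m : ℤ), -(m : ℤ)], zpowDiagGL_mem_unitaryGroupOfForm hϖσ _ (antitone_rev_vec m).2⟩ * Ψ y) *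
                (Ψ y')⁻¹ := by group
          _ = (Ψ x')⁻¹ * (Ψ x' * ⟨zpowDiagGL hϖ0 ![(m' : ℤ), -(m' : ℤ)], zpowDiagGL_mem_unitaryGroupOfForm hϖσ _ (antitone_rev_vec m').2⟩ * Ψ y') *
                (Ψ y')⁻¹ := by rw [← ha, hb]
          _ = _ := by group)
    have h0 := congrFun key 0
    simp only [Matrix.cons_val_zero, Nat.cast_inj] at h0
    exact h0

/-- **A Cartan generator exists**: some `t₁ ∈ G_v` has `w`-component `T⁻¹ · diag(ϖ, ϖ⁻¹) · T` (`diag(ϖ, ϖ⁻¹) ∈ U(σ_w, J₀)` because `σ_w ϖ = ϖ`;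
pulled back along the one-place model ★ `localPiNonsplitEquiv` and the frame `T`) — the `_ht₁` feed of socket #28i. [cite: BruhatTits1972, (4.4.3)] -/
theorem exists_generator_inert (w : UnitaryGroup.PlacesOver L v) (hw : IsCMField.complexConj L • w.1 = w.1)
    {ϖ : w.1.adicCompletion L} (hϖ : Valued.v ϖ = WithZero.exp (-1 : ℤ))
    (hϖσ : galAdicCompletionMap (L := L) (IsCMField.complexConj L) hw ϖ = ϖ)
    (T : GL (Fin 2) (w.1.adicCompletion L))
    (hTJ : UnitaryGroup.placeForm (Matrix.diagonal dV) w.1 =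
      formCongr (galAdicCompletionMap (L := L) (IsCMField.complexConj L) hw) T ((StdForm.antidiagonal 2).over (w.1.adicCompletion L))) :
    ∃ t₁ : UnitaryGroup.localPi L (IsCMField.complexConj L) 2 (Matrix.diagonal dV) v,
      Units.val ((t₁ : UnitaryGroup.LocalGLPi L 2 v) w) =
        ((T⁻¹ : GL (Fin 2) (w.1.adicCompletion L)) : Matrix (Fin 2) (Fin 2) (w.1.adicCompletion L)) *
          Matrix.diagonal ![ϖ, ϖ⁻¹] * (T : Matrix (Fin 2) (Fin 2) (w.1.adicCompletion L)) := by
  haveI : Algebra.IsQuadraticExtension (Fp L) L := IsCMField.isQuadraticExtension L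
  have hc : IsCMField.complexConj L ≠ 1 := IsCMField.complexConj_ne_one L
  have hϖ0 : ϖ ≠ 0 := uniformizer_ne_zero hϖ
  have hD : zpowDiagGL hϖ0 ![(1 : ℤ), -1] ∈
      unitaryGroupOfForm (galAdicCompletionMap (L := L) (IsCMField.complexConj L) hw) ((StdForm.antidiagonal 2).over (w.1.adicCompletion L)) :=
    zpowDiagGL_mem_unitaryGroupOfForm hϖσ _ (fun i => by fin_cases i <;> simp [Fin.rev])
  have hg : T⁻¹ * zpowDiagGL hϖ0 ![(1 : ℤ), -1] * T ∈
      unitaryGroupOfForm (galAdicCompletionMap (L := L) (IsCMField.complexConj L) hw) (UnitaryGroup.placeForm (Matrix.diagonal dV) w.1) := by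
    rw [hTJ, ← conj_mem_unitaryGroupOfForm_iff]
    rwa [show T * (T⁻¹ * zpowDiagGL hϖ0 ![(1 : ℤ), -1] * T) * T⁻¹ = zpowDiagGL hϖ0 ![(1 : ℤ), -1] by group]
  refine ⟨(localPiNonsplitEquiv (IsCMField.complexConj L) (Matrix.diagonal dV) hc w hw).symm ⟨_, hg⟩, ?_⟩
  have h1 := coe_localPiNonsplitEquiv_apply (IsCMField.complexConj L) (Matrix.diagonal dV) hc w hw
    ((localPiNonsplitEquiv (IsCMField.complexConj L) (Matrix.diagonal dV) hc w hw).symm ⟨_, hg⟩)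
  rw [ContinuousMulEquiv.apply_symm_apply] at h1
  rw [← h1, Units.val_mul, Units.val_mul, coe_zpowDiagGL]
  congr 2
  ext i j
  fin_cases i <;> fin_cases j <;> simp

omit [NumberField L] [IsCMField L] in
/-- the powers of a generator: `(t₁^m)_w = T⁻¹ · diag(ϖ^m, ϖ^{−m}) · T` — the `ht` hypothesis of `isCartanFamily_localInt_inert` and of ★ #27i for the family
`m ↦ t₁^m`. [cite: BruhatTits1972, (4.4.3)] -/
theorem coe_pow_of_coe_eq_conj_diagonal {Kw : Type} [Field Kw] {G : Type} [Group G] (f : G →* GL (Fin 2) Kw)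
    (T : GL (Fin 2) Kw) {ϖ : Kw} (t₁ : G)
    (ht₁ : Units.val (f t₁) = ((T⁻¹ : GL (Fin 2) Kw) : Matrix (Fin 2) (Fin 2) Kw) * Matrix.diagonal ![ϖ, ϖ⁻¹] * (T : Matrix (Fin 2) (Fin 2) Kw))
    (m : ℕ) :
    Units.val (f (t₁ ^ m)) = ((T⁻¹ : GL (Fin 2) Kw) : Matrix (Fin 2) (Fin 2) Kw) * Matrix.diagonal ![ϖ ^ m, (ϖ ^ m)⁻¹] * (T : Matrix (Fin 2) (Fin 2) Kw) := by
  have hTT : (T : Matrix (Fin 2) (Fin 2) Kw) * ((T⁻¹ : GL (Fin 2) Kw) : Matrix (Fin 2) (Fin 2) Kw) = 1 := by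
    rw [← Units.val_mul, mul_inv_cancel, Units.val_one]
  induction m with
  | zero =>
    have h1 : (Matrix.diagonal ![ϖ ^ 0, (ϖ ^ 0)⁻¹] : Matrix (Fin 2) (Fin 2) Kw) = 1 := by
      rw [← Matrix.diagonal_one]; congr 1; funext i; fin_cases i <;> simp
    rw [pow_zero, map_one, Units.val_one, h1, Matrix.mul_one, ← Units.val_mul, inv_mul_cancel, Units.val_one]
  | succ m ih =>
    rw [pow_succ, map_mul, Units.val_mul, ih, ht₁]
    have hd : (Matrix.diagonal ![ϖ ^ m, (ϖ ^ m)⁻¹] : Matrix (Fin 2) (Fin 2) Kw) * Matrix.diagonal ![ϖ, ϖ⁻¹] = Matrix.diagonal ![ϖ ^ (m + 1), (ϖ ^ (m + 1))⁻¹] := by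
      rw [Matrix.diagonal_mul_diagonal]; congr 1; funext i; fin_cases i <;> simp [pow_succ, mul_comm]
    calc ((T⁻¹ : GL (Fin 2) Kw) : Matrix (Fin 2) (Fin 2) Kw) * Matrix.diagonal ![ϖ ^ m, (ϖ ^ m)⁻¹] * (T : Matrix (Fin 2) (Fin 2) Kw) *
          (((T⁻¹ : GL (Fin 2) Kw) : Matrix (Fin 2) (Fin 2) Kw) * Matrix.diagonal ![ϖ, ϖ⁻¹] * (T : Matrix (Fin 2) (Fin 2) Kw))
        = ((T⁻¹ : GL (Fin 2) Kw) : Matrix (Fin 2) (Fin 2) Kw) * (Matrix.diagonal ![ϖ ^ m, (ϖ ^ m)⁻¹] *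
            ((T : Matrix (Fin 2) (Fin 2) Kw) * ((T⁻¹ : GL (Fin 2) Kw) : Matrix (Fin 2) (Fin 2) Kw)) * Matrix.diagonal ![ϖ, ϖ⁻¹]) *
            (T : Matrix (Fin 2) (Fin 2) Kw) := by simp only [Matrix.mul_assoc]
      _ = _ := by rw [hTT, Matrix.mul_one, hd]

end Summit.HodgeConjecture.HodgeConjecture.Cruxes.HLiu418.K2LiuCartanFamilyInert

end
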